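import Summits.Ventures.Crystal3D.Theorems.StickyWulffConstantNoReconstructionGainSlabOrbit
import HarnessLib

/-!
# Every single-family Barlow film satisfies the atom of `NoReconstructionGain` (all non-degenerate normals)

HONEST FRAMING. Part of the venture `Summits/Ventures/Crystal3D` (cell `crystal3d-full`), helper
`--supports` the crux `NoReconstructionGain` (stmt-Ventures-19144, route
`route-Ventures-StickyWulffConstant`), line `adhesion`; packages `…SlabRungs` / `…SlabOrbit` (the three
regimes `C = 0, 1, 2` in slab form) into single statements by the trichotomy
`C(ν) = #{τ : √(2/3)⟪ν, n⟫ + ⟪τ, ν⟫ < 0} ∈ {0, 1, 2}` (three `ν`-downward registry-up slots are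
impossible when `⟪ν, n⟫ ≥ 0`, since the three hollow values sum to `0`):

* `singleFamilyBarlowFilm_adhesion` (**rung**, registered by name): for every unit `ν` with `ν₃ ≥ 0`
  off the three tie circles `√(2/3) ν₃ + ⟪τ, ν⟫ = 0` (`τ ∈ {w, w − u, w − v}`), every `ρ ≥ 2` and every
  finite unit packing `X ⊇ P` around the `ν`-slab sample (`R = 2`) whose film lies in
  `B = Λ₀ ∪ (Λ₀ ± w)` above the cut: `#cross(P, X \ P) ≤ contactDeficiency (X \ P) + 18432 ρ`;
* `singleFamilyBarlowFilm_adhesion_orbit` (**rung**): the same for the family `g e₃` of any lattice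
  isometry `g` (`⟪ν, g e₃⟫ ≥ 0`, tie circles `√(2/3)⟪ν, g e₃⟫ + ⟪g τ, ν⟫ = 0`); `g = −1` gives the
  other hemisphere, so every unit normal is covered for every family up to the tie circles.

In words: an fcc slab of ANY orientation gains nothing from ANY film built on the Barlow positions of
ONE `{111}` family (fcc continuation, twin lamellae, hcp/dhcp, intrinsic/extrinsic faults, islands of
both hollow types, domain mixtures — every coordination), at order area.  Census class (i) of the crux:
closed.  lead folder RUNGS-g9.md (evidence on the item).

WHAT THIS IS NOT: the tie circles themselves (measure zero; a level registry slot); films mixing the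
four families (slot-rule recipe verified numerically only); off-Barlow films; rung F-C1 not moved.
-/

noncomputable section

namespace Summit.Ventures.Crystal3D.Theorems

open Summit.Ventures.Crystal3D Finset
open Literature.MathematicalPhysics.StatisticalMechanics (barlowPos fccStacking barlowOffset layerNormal constHagg
  contactDeficiency)
open scoped InnerProductSpace

/-- **Every single-family (basal) Barlow film above the cut satisfies the atom**, for every unit normal
with `ν₃ ≥ 0` off the three tie circles (`R = 2`, `C = 18432`; registered by name). -/
theorem singleFamilyBarlowFilm_adhesion :
    ∃ R C : ℝ, 1 ≤ R ∧ ∀ ν : EuclideanSpace ℝ (Fin 3), ‖ν‖ = 1 → ∀ ρ : ℝ, R ≤ ρ →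
      ∀ X P : Finset (EuclideanSpace ℝ (Fin 3)),
      (∀ p ∈ X, ∀ q ∈ X, p ≠ q → 1 ≤ dist p q) → P ⊆ X →
      (∀ p, p ∈ P ↔ (p ∈ fccStacking 1 (Real.sqrt (2 / 3)) ∧ -(2 * R) ≤ ⟪p, ν⟫_ℝ ∧
        ⟪p, ν⟫_ℝ ≤ -R ∧ ‖p‖ ^ 2 - ⟪p, ν⟫_ℝ ^ 2 ≤ ρ ^ 2)) →
      0 ≤ ν 2 →
      (∀ τ ∈ ([barlowOffset 1, barlowOffset 1 - barlowPos 1 (Real.sqrt (2 / 3)) constHagg 0 1 0,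
          barlowOffset 1 - barlowPos 1 (Real.sqrt (2 / 3)) constHagg 0 0 1] : List (EuclideanSpace ℝ (Fin 3))),
        Real.sqrt (2 / 3) * ν 2 + ⟪τ, ν⟫_ℝ ≠ 0) →
      (∀ q ∈ X \ P, q ∈ fccStacking 1 (Real.sqrt (2 / 3)) ∨
        q - barlowOffset 1 ∈ fccStacking 1 (Real.sqrt (2 / 3)) ∨
        q + barlowOffset 1 ∈ fccStacking 1 (Real.sqrt (2 / 3))) →
      (∀ q ∈ X \ P, -R < ⟪q, ν⟫_ℝ) →
      ((((P ×ˢ (X \ P)).filter fun pq => dist pq.1 pq.2 = 1).card : ℕ) : ℝ) ≤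
        contactDeficiency (X \ P) + C * ρ := by
  classical
  refine ⟨2, 18432, by norm_num, fun ν hν ρ hρ X P hX hPX hP hν2 hne hfilm habove => ?_⟩
  refine slabForm_of_localClosure ν hν ρ hρ X P hX hPX hP habove fun X' hPX' hX'X hclos' => ?_
  have hX' : ∀ p ∈ X', ∀ q ∈ X', p ≠ q → 1 ≤ dist p q := fun p hp q hq => hX p (hX'X hp) q (hX'X hq)
  have hPΛ : ∀ p ∈ P, p ∈ fccStacking 1 (Real.sqrt (2 / 3)) := fun p hp => ((hP p).1 hp).1
  have hfilm' : ∀ q ∈ X' \ P, q ∈ fccStacking 1 (Real.sqrt (2 / 3)) ∨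
      q - barlowOffset 1 ∈ fccStacking 1 (Real.sqrt (2 / 3)) ∨
      q + barlowOffset 1 ∈ fccStacking 1 (Real.sqrt (2 / 3)) := fun q hq =>
    hfilm q (mem_sdiff.2 ⟨hX'X (mem_sdiff.1 hq).1, (mem_sdiff.1 hq).2⟩)
  have hbelow : ∀ p ∈ P, ∀ q ∈ X' \ P, ⟪p, ν⟫_ℝ < ⟪q, ν⟫_ℝ := fun p hp q hq => by
    obtain ⟨-, -, h2, -⟩ := (hP p).1 hp
    linarith [habove q (mem_sdiff.2 ⟨hX'X (mem_sdiff.1 hq).1, (mem_sdiff.1 hq).2⟩)]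
  have hs0 : 0 ≤ Real.sqrt (2 / 3) * ν 2 := mul_nonneg (Real.sqrt_nonneg _) hν2
  have hsum : barlowOffset 1 + (barlowOffset 1 - barlowPos 1 (Real.sqrt (2 / 3)) constHagg 0 1 0) +
      (barlowOffset 1 - barlowPos 1 (Real.sqrt (2 / 3)) constHagg 0 0 1) = 0 := hollow_triple_sum
  have clos := clos_of_list ν X' P hclos'
  -- the three hollow values
  have hβ : ⟪barlowOffset 1, ν⟫_ℝ + ⟪barlowOffset 1 - barlowPos 1 (Real.sqrt (2 / 3)) constHagg 0 1 0, ν⟫_ℝ +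
      ⟪barlowOffset 1 - barlowPos 1 (Real.sqrt (2 / 3)) constHagg 0 0 1, ν⟫_ℝ = 0 := by
    rw [← inner_add_left, ← inner_add_left, hsum, inner_zero_left]
  have n1 := hne (barlowOffset 1) (by simp)
  have n2 := hne (barlowOffset 1 - barlowPos 1 (Real.sqrt (2 / 3)) constHagg 0 1 0) (by simp)
  have n3 := hne (barlowOffset 1 - barlowPos 1 (Real.sqrt (2 / 3)) constHagg 0 0 1) (by simp)
  have hT : ∀ τ ∈ ([barlowOffset 1, barlowOffset 1 - barlowPos 1 (Real.sqrt (2 / 3)) constHagg 0 1 0,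
          barlowOffset 1 - barlowPos 1 (Real.sqrt (2 / 3)) constHagg 0 0 1] : List (EuclideanSpace ℝ (Fin 3))), τ = barlowOffset 1 ∨ τ = barlowOffset 1 - barlowPos 1 (Real.sqrt (2 / 3)) constHagg 0 1 0 ∨
      τ = barlowOffset 1 - barlowPos 1 (Real.sqrt (2 / 3)) constHagg 0 0 1 := fun τ hτ => by
    simpa using hτ
  -- trichotomy on the signs: C(ν) ∈ {0, 1, 2}
  rcases n1.lt_or_gt with a1 | a1 <;> rcases n2.lt_or_gt with a2 | a2 <;> rcases n3.lt_or_gt with a3 | a3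
  · -- all three negative: impossible
    exfalso; linarith
  · -- C = 2 (w, wu overhang; wv not)
    exact twoOverhang_main X' P hX' hPX' ν _ _ _ hPΛ hfilm' hbelow
      (fun τ hτ => by simp only [List.mem_cons, List.mem_nil_iff, or_false] at hτ; tauto)
      (by simp) (by simp) (by simp) hsum hs0 a1 a2 a3 ((clos _ (by simp)).1 a1)
  · -- C = 2 (w, wv; wu not)
    exact twoOverhang_main X' P hX' hPX' ν _ _ _ hPΛ hfilm' hbelow
      (fun τ hτ => by simp only [List.mem_cons, List.mem_nil_iff, or_false] at hτ; tauto)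
      (by simp) (by simp) (by simp) (by rw [← hsum]; abel) hs0 a1 a3 a2 ((clos _ (by simp)).1 a1)
  · -- C = 1 (w)
    exact oneOverhang_main X' P hX' hPX' ν _ _ _ hPΛ hfilm' hbelow
      (fun τ hτ => by simp only [List.mem_cons, List.mem_nil_iff, or_false] at hτ; tauto)
      (by simp) (by simp) (by simp) hsum hs0 a1 a2 a3
      ((clos _ (by simp)).1 a1) ((clos _ (by simp)).2 a2)
  · -- C = 2 (wu, wv; w not)
    exact twoOverhang_main X' P hX' hPX' ν _ _ _ hPΛ hfilm' hbelow
      (fun τ hτ => by simp only [List.mem_cons, List.mem_nil_iff, or_false] at hτ; tauto)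
      (by simp) (by simp) (by simp) (by rw [← hsum]; abel) hs0 a2 a3 a1 ((clos _ (by simp)).1 a2)
  · -- C = 1 (wu)
    exact oneOverhang_main X' P hX' hPX' ν _ _ _ hPΛ hfilm' hbelow
      (fun τ hτ => by simp only [List.mem_cons, List.mem_nil_iff, or_false] at hτ; tauto)
      (by simp) (by simp) (by simp) (by rw [← hsum]; abel) hs0 a2 a1 a3
      ((clos _ (by simp)).1 a2) ((clos _ (by simp)).2 a1)
  · -- C = 1 (wv)
    exact oneOverhang_main X' P hX' hPX' ν _ _ _ hPΛ hfilm' hbelow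
      (fun τ hτ => by simp only [List.mem_cons, List.mem_nil_iff, or_false] at hτ; tauto)
      (by simp) (by simp) (by simp) (by rw [← hsum]; abel) hs0 a3 a1 a2
      ((clos _ (by simp)).1 a3) ((clos _ (by simp)).2 a1)
  · -- C = 0
    refine nTilt_main X' P hX' hPX' ν hν hPΛ hfilm' hbelow ?_ fun p hp q hq hd τ hτ => ?_
    · intro τ hτ
      rcases hT τ hτ with rfl | rfl | rfl
      exacts [a1, a2, a3]
    · have hpos : 0 < Real.sqrt (2 / 3) * ν 2 + ⟪τ, ν⟫_ℝ := by
        rcases hT τ hτ with rfl | rfl | rfl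
        exacts [a1, a2, a3]
      have := (clos τ hτ).2 hpos p hp q hq hd
      rw [show p - layerNormal (Real.sqrt (2 / 3)) - τ = p - (layerNormal (Real.sqrt (2 / 3)) + τ) by abel]
      exact this

/-- **The same for the `{111}` family `g e₃` of any lattice isometry `g`** (registered by name);
`g = −1` covers the hemisphere `ν₃ ≤ 0`. -/
theorem singleFamilyBarlowFilm_adhesion_orbit :
    ∃ R C : ℝ, 1 ≤ R ∧ ∀ ν : EuclideanSpace ℝ (Fin 3), ‖ν‖ = 1 → ∀ ρ : ℝ, R ≤ ρ →
      ∀ X P : Finset (EuclideanSpace ℝ (Fin 3)),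
      (∀ p ∈ X, ∀ q ∈ X, p ≠ q → 1 ≤ dist p q) → P ⊆ X →
      (∀ p, p ∈ P ↔ (p ∈ fccStacking 1 (Real.sqrt (2 / 3)) ∧ -(2 * R) ≤ ⟪p, ν⟫_ℝ ∧
        ⟪p, ν⟫_ℝ ≤ -R ∧ ‖p‖ ^ 2 - ⟪p, ν⟫_ℝ ^ 2 ≤ ρ ^ 2)) →
      ∀ g : EuclideanSpace ℝ (Fin 3) ≃ₗᵢ[ℝ] EuclideanSpace ℝ (Fin 3),
      (∀ p ∈ fccStacking 1 (Real.sqrt (2 / 3)), g p ∈ fccStacking 1 (Real.sqrt (2 / 3))) →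
      (∀ p ∈ fccStacking 1 (Real.sqrt (2 / 3)), g.symm p ∈ fccStacking 1 (Real.sqrt (2 / 3))) →
      0 ≤ ⟪ν, g (EuclideanSpace.single (2 : Fin 3) (1 : ℝ))⟫_ℝ →
      (∀ τ ∈ ([barlowOffset 1, barlowOffset 1 - barlowPos 1 (Real.sqrt (2 / 3)) constHagg 0 1 0,
          barlowOffset 1 - barlowPos 1 (Real.sqrt (2 / 3)) constHagg 0 0 1] : List (EuclideanSpace ℝ (Fin 3))),
        Real.sqrt (2 / 3) * ⟪ν, g (EuclideanSpace.single (2 : Fin 3) (1 : ℝ))⟫_ℝ + ⟪g τ, ν⟫_ℝ ≠ 0) →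
      (∀ q ∈ X \ P, q ∈ fccStacking 1 (Real.sqrt (2 / 3)) ∨
        q - g (barlowOffset 1) ∈ fccStacking 1 (Real.sqrt (2 / 3)) ∨
        q + g (barlowOffset 1) ∈ fccStacking 1 (Real.sqrt (2 / 3))) →
      (∀ q ∈ X \ P, -R < ⟪q, ν⟫_ℝ) →
      ((((P ×ˢ (X \ P)).filter fun pq => dist pq.1 pq.2 = 1).card : ℕ) : ℝ) ≤
        contactDeficiency (X \ P) + C * ρ := by
  classical
  have hT := slabRung_transport
    (fun ν => 0 ≤ ν 2 ∧ ∀ τ ∈ ([barlowOffset 1, barlowOffset 1 - barlowPos 1 (Real.sqrt (2 / 3)) constHagg 0 1 0,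
          barlowOffset 1 - barlowPos 1 (Real.sqrt (2 / 3)) constHagg 0 0 1] : List (EuclideanSpace ℝ (Fin 3))),
        Real.sqrt (2 / 3) * ν 2 + ⟪τ, ν⟫_ℝ ≠ 0) (by
      obtain ⟨R, C, hR, h⟩ := singleFamilyBarlowFilm_adhesion
      exact ⟨R, C, hR, fun ν hν ρ hρ X P hX hPX hP hreg hfilm habove =>
        h ν hν ρ hρ X P hX hPX hP hreg.1 hreg.2 hfilm habove⟩)
  obtain ⟨R, C, hR, h⟩ := hT
  refine ⟨R, C, hR, fun ν hν ρ hρ X P hX hPX hP g hg hg' h0 hreg => h ν hν ρ hρ X P hX hPX hP g hg hg' ?_⟩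
  have e2 : (g.symm ν) 2 = ⟪ν, g (EuclideanSpace.single (2 : Fin 3) (1 : ℝ))⟫_ℝ := by
    have : ⟪g.symm ν, EuclideanSpace.single (2 : Fin 3) (1 : ℝ)⟫_ℝ = (g.symm ν) 2 := by
      simp [EuclideanSpace.inner_single_right]
    rw [← this, ← g.inner_map_map, LinearIsometryEquiv.apply_symm_apply]
  have et : ∀ τ : EuclideanSpace ℝ (Fin 3), ⟪τ, g.symm ν⟫_ℝ = ⟪g τ, ν⟫_ℝ := fun τ => by
    rw [← g.inner_map_map, LinearIsometryEquiv.apply_symm_apply]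
  refine ⟨by rw [e2]; exact h0, fun τ hτ => ?_⟩
  rw [e2, et]
  exact hreg τ hτ

end Summit.Ventures.Crystal3D.Theorems

end
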